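import Summits.BirchSwinnertonDyer.Rank1Residual.X11b.ShapiroPairs
import HarnessLib

/-!
# BSD rank-≤1 residual cell, class X7 (good SUPERSINGULAR reduction at `p`, rank one): `BSD(E,5)`
# for the three window residue pairs `7728t1@5`, `14352bh1@5`, `17766bb1@5` from PUBLISHED theorems
# + ONE full `5`-descent certificate line per pair (exploratory mode at SURJECTIVE image; GRH)

HONEST FRAMING (cell `b2b-bsdres-*`, verbatim): prove what is provable now; shrink each hard class
to its core with data; no claim beyond stated classes; COMBINATION classes deleted from PUBLISHED
theorems only, CONSTRUCTION-shaped remainder typed; this is not "finishing BSD". Class X7 stays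
CONSTRUCTION-SHAPED; everything here is PER PAIR; no lane verdict is changed; no named fact; nothing
is booked by this unit (booking and flags are the lane's / referee A's).

Unit `b2b-bsdres-x11c` (the cell's `p`-descent engines), gen 14, serving the X7 owners: the hyp
RES-ROADMAP GEN 29 §4.6 lists `7728t1@5`, `14352bh1@5`, `17766bb1@5` (X7, `r_an = 1`, good
supersingular at `5`, `ρ̄_{E,5}` SURJECTIVE, `#Ш_an = 1`, Tamagawa products `50`, `200`, `50`:
two split-multiplicative primes with `5 ∣ c_ℓ`) in category E — NO per-pair route on file (the
Kurihara / Kim signed-Selmer routes need `ord₅ ∏ c_ℓ < 2`, `Supersingular/X7KuriharaLevelTwo.lean`: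
"NOT served"). They are closed PER PAIR, CONDITIONALLY ON GRH for the class group of one number
field each, by the FULL `5`-DESCENT over ℚ in the degree-`24` field `R = ℚ(T')` of ONE
`5`-torsion point (x11c engine `x5desc` = gen 13's `s4desc` in its GEN 14 exploratory `GL₂` mode,
kit **j112718**, certificates `HOME/b2b-bsdres-x11c/gen14/gl2/j112718/`). SOUNDNESS at a
SURJECTIVE image (no Maschke splitting): the Weil-pairing Kummer map
`w_* : H¹(ℚ, E[5]) → H¹(ℚ, Map(E[5]∖0, μ₅)) = Rˣ/Rˣ⁵` (Shapiro + Kummer) is INJECTIVE because its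
kernel is a quotient of `ker(H¹(G, E[5]) → H¹(G, Map(E[5]∖0, μ₅)))` and `H¹(GL₂(𝔽₅), 𝔽₅²) = 0`
(the central element `2·I` acts by `2 ≠ 1`); the computed group
`Fake(E) = {ξ ∈ R(S,5) : δξ = ξ^a, loc_ℓ ξ ∈ ⟨f_{T'}(E(ℚ_ℓ))⟩ (ℓ ∣ 5N)}` is cut out by conditions
NECESSARY for elements of `w_*Sel⁵(E/ℚ)` (unramified outside `S`; the scalar automorphism
`δ : T' ↦ [a]T'` of `R` — `Aut(R) = B/M ≅ 𝔽₅ˣ` — multiplies Weil-pairing classes by `a`; the local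
Kummer images are sampled to their KNOWN dimension `dim E(ℚ_ℓ)[5] + [ℓ = 5]`, which also certifies
that `w_*` is injective on them), so `dim Sel⁵(E/ℚ) ≤ dim Fake(E)` with NO bound on the defect in
this mode: the descent is conclusive exactly when `dim Fake(E) = rank + dim E(ℚ)[5]`, the lower
bound from Cremona's generator. For all three pairs **`dim_𝔽₅ Fake(E) = 1 = rank`** (generator
image non-zero, in `Fake`, exponent vector uniquely determined by characters), hence
**`#Sel^(5)(E/ℚ) = 5`**, `Ш(E/ℚ)[5] = 0` — mode **GRH**: the class groups (`ℤ/4`, `ℤ/4`, `ℤ/8`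
by `bnfinit`) are NOT certified (`|d_R| = 2³²·5²³·23¹⁶ ≈ 10⁴⁷` twice and `3³⁰·5²³·47¹⁶ ≈ 10⁵⁷`: Zimmert bounds `Z ≈ 10¹²`–`10¹⁷`, beyond the lane's reach), and without that
certification `R(S,5)` could be larger than computed. `5`-saturation of `R(S,5)` and the
Galois-action matrix are PROVED by quintic characters as in gen 13.

What enters the kernel per pair is ONE line: the hypothesis `hSel : #Sel^(5)(E/ℚ) = 5 ^ r_an`
(here GRH-conditional, as stated) of the tree's class-free consumer
`Typed.bsdp_of_card_selmerGroup_eq_pow_analyticRank` through x11c gen 12's literal-model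
instantiation `X11b.bsdp_of_ainvs_of_card_selmerGroup` (GZK `hGZK`, `r_an ≤ 1`, `p ∤ #Ш_an` ⟹
Miller's `BSDp`; `Δ ≠ 0` decided in the kernel). Non-kernel inputs per pair: `r_an = 1` and
`#Ш_an = 1` (Cremona; the cell's engines) and the certificate line. PER PAIR; not a class theorem;
nothing booked by this unit.

References: E. F. Schaefer, M. Stoll, Trans. AMS 356 (2004) §2–3, §5; J. H. Silverman, *AEC*
(2009) X.1, X.4 [SilvermanAEC2009]; T. Lawson, C. Wuthrich, Res. Number Theory 2 (2016)
(vanishing of `H¹(G, E[p])`); R. L. Miller, LMS JCM 14 (2011) §1 [Miller2011LMS]; Cremona's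
tables [Cremona2006].
-/

set_option autoImplicit false

noncomputable section

open scoped Classical

open WeierstrassCurve Literature.NumberTheory.EllipticCurves
  Literature.NumberTheory.EllipticCurves.Rank1Residual
  Literature.NumberTheory.EllipticCurves.Rank1Residual.Typed
  Literature.NumberTheory.EllipticCurves.Rank1Residual.X11RankOneCertificates
  Summit.BirchSwinnertonDyer.Rank1Residual.X11b

namespace Summit.BirchSwinnertonDyer.Rank1Residual.Supersingular

/-- **`BSD(E,5)` for `7728t1`** [GRH] (`N = 7728 = 2⁴·3·7·23`, good supersingular at `5`;
Cremona model `[0, 1, 0, -253, -7705]`; `ρ̄_{E,5}` surjective; rank `1`, generator `(47, 294)`,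
`E(ℚ)_tors = 0`, `∏ c_ℓ = 50`, `#Ш_an = 1`) from GZK and the single certificate line
`#Sel^(5)(E/ℚ) = 5 ^ r_an`: full `5`-descent (x11c GEN 14 `x5desc`, exploratory `GL₂` mode, kit
j112718) in `R = ℚ(T')`, `[R:ℚ] = 24`, `|d_R| = 2³²·5²³·23¹⁶` (`5` totally ramified), subfield degrees
`{1,6,12,24}`, `S = {2,3,5,7,23}`, `Cl(R) ≅ ℤ/4` **under GRH** (uncertified), `38` generators of
`R(S,5)` (`5`-saturated by `110` quintic characters), `δ`-eigenspace of dimension `8` (Galois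
action PROVED by characters, `38/38` columns), local targets `dim J_ℓ = 0, 1, 1, 1, 0` at
`ℓ = 2, 3, 5, 7, 23` (`#E(ℚ₃)[5] = #E(ℚ₇)[5] = 5`) all reached, `K_S(R) = 0`,
**`dim_𝔽₅ Fake(E) = 1 = rank`** with the generator's Kummer image its non-zero element — hence
**`#Sel^(5)(E/ℚ) = 5`**, mode **GRH**. Kernel: `Δ ≠ 0`. Binders: `hGZK` (published), `r_an ≤ 1`
and `#Ш_an` a `5`-adic unit (Cremona / the cell's engines), `hSel` (this certificate,
GRH-conditional). [cite: Miller2011LMS, §1 and Def. 1.1] [cite: Cremona2006, Table 1 (Cremona label 7728t1)] -/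
theorem bsdp_s7728t1 (hGZK : rank_eq_analyticRank_of_analyticRank_le_one)
    (W : WeierstrassCurve ℚ) (hW : W = ⟨0, 1, 0, -253, -7705⟩)
    (hr : W.analyticRank ≤ 1) {q : ℚ} (hq : shaAn W = (q : ℂ)) (hv : padicValRat 5 q = 0)
    (hSel : Nat.card (W.selmerGroup (5 : ℤ)) = 5 ^ W.analyticRank) : BSDp W 5 := by
  subst hW
  haveI : Fact (Nat.Prime 5) := ⟨by norm_num⟩
  exact bsdp_of_ainvs_of_card_selmerGroup hGZK 0 1 0 (-253) (-7705) (by decide +kernel) 5 hr hq hv hSel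

/-- **`BSD(E,5)` for `14352bh1`** [GRH] (`N = 14352 = 2⁴·3·13·23`, good supersingular at `5`;
Cremona model `[0, 1, 0, -166613, -21455934]`; `ρ̄_{E,5}` surjective; rank `1`, generator
`(514, 5382)`, `E(ℚ)_tors ≅ ℤ/2`, `∏ c_ℓ = 200`, `#Ш_an = 1`) from GZK and the single
certificate line `#Sel^(5)(E/ℚ) = 5 ^ r_an`: full `5`-descent (x11c GEN 14 `x5desc`, exploratory
`GL₂` mode, kit j112718) in `R = ℚ(T')`, `[R:ℚ] = 24`, subfield degrees `{1,6,12,24}`,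
`S = {2,3,5,13,23}`, `Cl(R) ≅ ℤ/4` **under GRH** (uncertified), `38` generators of `R(S,5)`
(`5`-saturated, `110` characters), `δ`-eigenspace of dimension `8` (Galois action PROVED by
characters), local targets `0, 1, 1, 1, 0` at `ℓ = 2, 3, 5, 13, 23` all reached, `K_S(R) = 0`,
**`dim_𝔽₅ Fake(E) = 1 = rank`** (generator image non-zero, in `Fake`) — hence
**`#Sel^(5)(E/ℚ) = 5`**, mode **GRH**. Kernel: `Δ ≠ 0`. Binders: `hGZK` (published), `r_an ≤ 1`
and `#Ш_an` a `5`-adic unit (Cremona / the cell's engines), `hSel` (this certificate,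
GRH-conditional). [cite: Miller2011LMS, §1 and Def. 1.1] [cite: Cremona2006, Table 1 (Cremona label 14352bh1)] -/
theorem bsdp_s14352bh1 (hGZK : rank_eq_analyticRank_of_analyticRank_le_one)
    (W : WeierstrassCurve ℚ) (hW : W = ⟨0, 1, 0, -166613, -21455934⟩)
    (hr : W.analyticRank ≤ 1) {q : ℚ} (hq : shaAn W = (q : ℂ)) (hv : padicValRat 5 q = 0)
    (hSel : Nat.card (W.selmerGroup (5 : ℤ)) = 5 ^ W.analyticRank) : BSDp W 5 := by
  subst hW
  haveI : Fact (Nat.Prime 5) := ⟨by norm_num⟩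
  exact bsdp_of_ainvs_of_card_selmerGroup hGZK 0 1 0 (-166613) (-21455934) (by decide +kernel) 5 hr hq hv hSel

/-- **`BSD(E,5)` for `17766bb1`** [GRH] (`N = 17766 = 2·3³·7·47`, good supersingular at `5`;
Cremona model `[1, -1, 1, -20750, -1145059]`; `ρ̄_{E,5}` surjective; rank `1`, generator
`(−83, 55)`, `E(ℚ)_tors = 0`, `∏ c_ℓ = 50`, `#Ш_an = 1`) from GZK and the single certificate line
`#Sel^(5)(E/ℚ) = 5 ^ r_an`: full `5`-descent (x11c GEN 14 `x5desc`, exploratory `GL₂` mode, kit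
j112718) in `R = ℚ(T')`, `[R:ℚ] = 24`, subfield degrees `{1,6,12,24}`, `S = {2,3,5,7,47}`,
`Cl(R) ≅ ℤ/8` **under GRH** (uncertified), `38` generators of `R(S,5)` (`5`-saturated, `90`
characters), `δ`-eigenspace of dimension `8` (Galois action PROVED by characters), local targets
`1, 0, 1, 1, 0` at `ℓ = 2, 3, 5, 7, 47` all reached, `K_S(R) = 0`,
**`dim_𝔽₅ Fake(E) = 1 = rank`** (generator image non-zero, in `Fake`) — hence
**`#Sel^(5)(E/ℚ) = 5`**, mode **GRH**. Kernel: `Δ ≠ 0`. Binders: `hGZK` (published), `r_an ≤ 1`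
and `#Ш_an` a `5`-adic unit (Cremona / the cell's engines), `hSel` (this certificate,
GRH-conditional). [cite: Miller2011LMS, §1 and Def. 1.1] [cite: Cremona2006, Table 1 (Cremona label 17766bb1)] -/
theorem bsdp_s17766bb1 (hGZK : rank_eq_analyticRank_of_analyticRank_le_one)
    (W : WeierstrassCurve ℚ) (hW : W = ⟨1, -1, 1, -20750, -1145059⟩)
    (hr : W.analyticRank ≤ 1) {q : ℚ} (hq : shaAn W = (q : ℂ)) (hv : padicValRat 5 q = 0)
    (hSel : Nat.card (W.selmerGroup (5 : ℤ)) = 5 ^ W.analyticRank) : BSDp W 5 := by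
  subst hW
  haveI : Fact (Nat.Prime 5) := ⟨by norm_num⟩
  exact bsdp_of_ainvs_of_card_selmerGroup hGZK 1 (-1) 1 (-20750) (-1145059) (by decide +kernel) 5 hr hq hv hSel

end Summit.BirchSwinnertonDyer.Rank1Residual.Supersingular

end
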